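import Literature.AnabelianGeometry.SemiGraphs.TemperedAnabelianMorphisms
import Literature.AnabelianGeometry.EtaleTheta.Cyclotome

/-!
# Tempered absoluteness ([SemiAnbd] §6: Cor. 6.10, Cor. 6.11, Thm. 6.12; Rmk. 6.12.1 noted)

Mochizuki, *Semi-graphs of anabelioids*, Publ. RIMS **42** (2006) [SemiAnbd], §6, author's
manuscript pp. 77–78: the tempered analogues ("temp-") of the notions of absoluteness of
[Mzk8] = Mochizuki, *Galois sections in absolute anabelian geometry*, Nagoya Math. J. **179**
(2005), Definition 4.1 (iv) (integrally / discretely absolute cusps) and Definition 4.8 (unitwise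
absolute); Corollary 6.10 (Tempered Absoluteness) (i), (ii); Corollary 6.11 (Unitwise and Integral
Temp-absoluteness for Genus Zero); Theorem 6.12 (Rigidity of Cuspidal Geometric Decomposition
Groups); Remark 6.12.1. [cite: MochizukiSemiAnbd2006, §6 pp.77-78]

## Level of the typing

Over the curve-level interface `TemperedCurve p` (`TemperedAnabelian.lean`; ruling η of
abc-iut-L3-lead) and the flags of `TemperedAnabelianMorphisms.lean`.  The [Mzk8] §4 structures these statements are about are deep
geometric inputs absent from the tree and are recorded as INTERFACE data (`CuspidalStructures`,
`KummerUnitData`, `CyclotomeTransport`) with the corresponding ORIGIN predicates carried by the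
hypothesis structure `Ω : AbsolutenessOrigin p` (extending `TemperedMorphismOrigin p`):

* [Mzk8] §4 p. 33 / Def. 4.1 (i)–(iii): for a `K`-rational cusp `x`, the splittings of
  `1 → I_x (≅ Ẑ(1)) → D_x → G_K → 1` form a torsor over `H¹(G_K, Ẑ(1)) ≅ (K^×)^∧`; an *integral*
  (resp. *discrete*) structure on `D_x` is an `O_K^×`- (resp. `K^×`-) torsor structure, and the
  *canonical* ones come from the cotangent space `ω_x` (integral: when `X_K` has stable reduction
  over `O_K`).  A splitting is recorded by its image, a closed complement `S` of `I_x` in `D_x`; a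
  structure by the SET of splittings it consists of (`canonicalIntegral x`, `canonicalDiscrete x`).
* [Mzk8] Def. 4.8: "`X_K` is unitwise absolute if … the isomorphism
  `H¹(Π_{X_K}, μ_Ẑ(K)) ≅ H¹(Π_{Y_L}, μ_Ẑ(L))` induced by `α` maps the image of `Γ(X_K, O^×_{X_K})`
  via the Kummer map onto the image of `Γ(Y_L, O^×_{Y_L})`" — recorded as an abstract cohomology
  group with the Kummer image of the units and, for a pair, the transport maps induced by
  isomorphisms of (tempered, resp. profinite) fundamental groups.
* [Mzk8] Thm. 4.3 / [SemiAnbd] Thm. 6.12: the cyclotome `μ_Ẑ(K̄) = Hom(ℚ/ℤ, μ_{ℚ/ℤ}(K̄))` is the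
  tree's `EtaleTheta.cyclotome (AlgebraicClosure ℚ_[p])ˣ` (`Λ(A) = lim A[n]`, seat L2-t3); "the natural
  isomorphism `μ_Ẑ(K̄) ≅ I_x`" (roots of local coordinates) and "the isomorphism `μ_Ẑ(K̄) ≅ μ_Ẑ(L̄)`
  induced by `α`" (group-theoretic reconstruction of cyclotomes, [AbsAnab]) are interface data;
  since all curves of `TemperedCurve p` live inside the one algebraic closure `K̄ = AlgebraicClosure ℚ_[p]`,
  `μ_Ẑ(K̄) = μ_Ẑ(L̄)` is literally one group here.

"temp-absolute" (p. 77: "tempered analogues … which we denote by means of a prefix 'temp-'")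
quantifies over isomorphisms of TEMPERED groups `Π^temp_{X_K} ≅ Π^temp_{Y_L}` for ALL hyperbolic
curves `Y_L`; "absolute" over isomorphisms of the profinite completions.  The quantification "for
every `Y_L`" ranges over GENUINE data only, i.e. over `Y : TemperedCurve p` with
`Ω.IsHyperbolicCurveOrigin Y` (junk interface data must not count); it is restricted to curves over
extensions of the SAME `ℚ_p` (an isomorphism of [tempered] fundamental groups of hyperbolic curves
over `p`-adic and `p'`-adic fields forces `p = p'`, so nothing printed is lost).  Every printed result is typed (a) as a PREDICATE on the data and
(b) as the printed statement `…Holds Ω`; nothing is asserted.  -- TODO-merge: abc-iut-L4-t1 /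
L4-t4 ([Mzk8] §4 and the [AbsAnab] cyclotome reconstruction), abc-iut-L2-t3 (Kummer classes).
Remark 6.12.1 (p. 78) is a remark on proofs: Thm. 6.8 (iii), (iv), Cor. 6.9 "do not follow
formally from their profinite analogues, since … it is by no means clear that any
`Π_{X_K}`-conjugate of the decomposition group of a closed point that happens to be contained in
`Π^temp_{X_K} ⊆ Π_{X_K}` is necessarily a `Π^temp_{X_K}`-conjugate of the decomposition group of a
closed point" — an open question, NOT typed as a Literature fact (cell policy: conjectures / open
questions are Summits-side `@[conjecture]` obligations if ever needed); recorded here so the census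
row `SemiAnbd:Rmk6.12.1` is accounted for.  No statement is strengthened; nothing here takes a side
on [IUTchIII] Cor. 3.12.
-/

noncomputable section

namespace Literature.AnabelianGeometry.SemiGraphs

open scoped Pointwise
open Literature.AnabelianGeometry.EtaleTheta (cyclotome)


variable {p : ℕ} [Fact p.Prime]

namespace TemperedCurve

/-! ### [Mzk8] §4: splittings and structures on cuspidal decomposition groups -/

/-- A cusp `x` is `K`-*rational* (`x ∈ X̄_K(K)`, [Mzk8] §4 p. 33): `D_x` surjects onto
`G_K = Fix(K) ≤ Gal(ℚ̄_p/ℚ_p)` (the range of `aug`, `range_aug`; audit A-L3t4-S1 / ruling λ: onto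
`G_K`, not onto all of `Gal(ℚ̄_p/ℚ_p)`). [cite: MochizukiSemiAnbd2006, §6 p.77] -/
def IsRationalPt (X : TemperedCurve p) (x : X.Pt) : Prop :=
  Set.SurjOn X.aug (X.decomp x) (X.GK : Set (GQp p))

/-- A *splitting* of `1 → I_x → D_x → G_K → 1` ([Mzk8] §4 p. 33), recorded by its image: a closed
subgroup `S ⊆ D_x` with `S ∩ I_x = 1` and `S · I_x = D_x`. [cite: MochizukiSemiAnbd2006, §6 p.77] -/
def IsSplittingSubgroup (X : TemperedCurve p) (x : X.Pt) (S : Subgroup X.PiTemp) : Prop :=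
  IsClosed (S : Set X.PiTemp) ∧ S ≤ X.decomp x ∧ S ⊓ X.inertia x = ⊥ ∧ S ⊔ X.inertia x = X.decomp x

/-- `D̂_x ⊆ Π_{X_K}`: the closure of the image of `D_x` in the profinite completion (p. 77: "Observe
that `D̂_x` also forms a 'profinite `D_x ⊆ Π_{X_K}`' in the sense of [Mzk8]").
[cite: MochizukiSemiAnbd2006, §6 p.77] -/
def decompHat (X : TemperedCurve p) (x : X.Pt) : Subgroup X.PiHat :=
  ((X.decomp x).map X.toHat.toMonoidHom).topologicalClosure

/-- Transport of a set of subgroups of `Π^temp_{X_K}` to the profinite completion (closures of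
images). [cite: MochizukiSemiAnbd2006, §6 p.77] -/
def hatOf (X : TemperedCurve p) (𝒮 : Set (Subgroup X.PiTemp)) : Set (Subgroup X.PiHat) :=
  (fun S => (S.map X.toHat.toMonoidHom).topologicalClosure) '' 𝒮

end TemperedCurve

/-- **[Mzk8] Definition 4.1 (ii), (iii)** (Nagoya Math. J. 179, p. 34) as INTERFACE data on a §6
datum: "If `X_K` has stable reduction over `O_K` (respectively, `X_K` is arbitrary), then the
particular integral (respectively, discrete) structure on `D_x` arising from a generator of the rank
one free `O_K`-submodule of `ω_x` determined by the stable reduction of `X_K` (respectively, any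
nonzero element of `ω_x`) will be referred to as the *canonical integral* (respectively, *discrete*)
structure on the cuspidal decomposition group `D_x`" — an `O_K^×`- (resp. `K^×`-) torsor of
splittings of `D_x ↠ G_K`, recorded as a set of splitting subgroups, for each `K`-rational cusp
`x`.  INTERFACE BOUNDARY: cotangent spaces, stable models and the torsor structure are not in the
tree -- TODO-merge: abc-iut-L4-t1 / L4-t4. [cite: MochizukiSemiAnbd2006, §6 p.77] -/
structure CuspidalStructures (X : TemperedCurve p) : Type where
  /-- "`X_K` has stable reduction over `O_K`" — a flag CERTIFIED only through
  `AbsolutenessOrigin.IsStructuresOrigin` (never asserted for bare data); to be tied to the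
  stable-model / `StableReductionTower` data of [SemiAnbd] Ex. 5.6 (seat abc-iut-L3-t3) at merge -/
  HasStableReduction : Prop
  /-- the canonical integral structure on `D_x` (meaningful for `K`-rational cusps `x` when `X_K` has
  stable reduction) -/
  canonicalIntegral : X.Pt → Set (Subgroup X.PiTemp)
  /-- the canonical discrete structure on `D_x` (meaningful for `K`-rational cusps `x`) -/
  canonicalDiscrete : X.Pt → Set (Subgroup X.PiTemp)
  /-- an integral structure refines the discrete one (`O_K^× ⊆ K^×`) -/
  canonicalIntegral_subset : ∀ x, canonicalIntegral x ⊆ canonicalDiscrete x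
  /-- structures consist of splittings of `1 → I_x → D_x → G_K → 1` -/
  isSplitting_of_mem : ∀ x, X.IsCusp x → X.IsRationalPt x →
    ∀ S ∈ canonicalDiscrete x, X.IsSplittingSubgroup x S
  /-- the canonical discrete structure at a rational cusp is nonempty -/
  canonicalDiscrete_nonempty : ∀ x, X.IsCusp x → X.IsRationalPt x → (canonicalDiscrete x).Nonempty
  /-- under stable reduction the canonical integral structure at a rational cusp is nonempty -/
  canonicalIntegral_nonempty : HasStableReduction → ∀ x, X.IsCusp x → X.IsRationalPt x →
    (canonicalIntegral x).Nonempty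

/-- **[Mzk8] Definition 4.8** (p. 40) as INTERFACE data on a §6 datum: the cohomology group
`H¹(Π_{X_K}, μ_Ẑ(K))` (equivalently, by goodness of `Π^temp_{X_K}`, p. 77, `H¹(Π^temp_{X_K}, μ_Ẑ(K))`)
and "the image of `Γ(X_K, O^×_{X_K})` via the Kummer map".  INTERFACE BOUNDARY: continuous
cohomology with cyclotome coefficients and the units of the curve are not in the tree
-- TODO-merge: abc-iut-L2-t3 (Kummer classes), abc-iut-L4-t1. [cite: MochizukiSemiAnbd2006, §6 p.77] -/
structure KummerUnitData (X : TemperedCurve p) : Type 1 where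
  /-- `H¹(Π_{X_K}, μ_Ẑ(K))` -/
  H1 : Type
  [addCommGroup : AddCommGroup H1]
  /-- the image of `Γ(X_K, O^×_{X_K})` under the Kummer map -/
  unitImage : AddSubgroup H1

attribute [instance] KummerUnitData.addCommGroup

/-- For a pair `X_K`, `Y_L`: the maps on `H¹(−, μ_Ẑ(−))` "induced by `α`" ([Mzk8] Def. 4.8), for
`α` an isomorphism of tempered fundamental groups resp. of their profinite completions (through the
group-theoretic identification `μ_Ẑ(K) ≅ μ_Ẑ(L)`).  INTERFACE BOUNDARY as above.
[cite: MochizukiSemiAnbd2006, §6 p.77] -/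
structure KummerTransport {X : TemperedCurve p} {Y : TemperedCurve p}
    (kX : KummerUnitData X) (kY : KummerUnitData Y) : Type where
  /-- transport along an isomorphism of tempered groups -/
  h1OfTemp : (X.PiTemp ≃ₜ* Y.PiTemp) → (kX.H1 ≃+ kY.H1)
  /-- transport along an isomorphism of profinite completions -/
  h1OfHat : (X.PiHat ≃ₜ* Y.PiHat) → (kX.H1 ≃+ kY.H1)

/-- **[Mzk8] Theorem 4.3 / [SemiAnbd] Theorem 6.12** interface data for a pair `X_K`, `Y_L`: for each
`K`-rational cusp `x` "the natural isomorphism `μ_Ẑ(K̄) ≅ I_x`" obtained "by considering roots of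
local coordinates" ([Mzk8] p. 36), with `μ_Ẑ(K̄) = cyclotome (AlgebraicClosure ℚ_[p])ˣ` (the tree's
`Λ(A) = lim A[n]`), and the isomorphism "`μ_Ẑ(K̄) ≅ μ_Ẑ(L̄)` induced by `α`" for an isomorphism of
tempered groups `α` (group-theoretic reconstruction of cyclotomes).  INTERFACE BOUNDARY
-- TODO-merge: abc-iut-L4-t4 ([AbsAnab] Prop. 1.2.1), abc-iut-L2-t3.
[cite: MochizukiSemiAnbd2006, Thm 6.12 p.78] -/
structure CyclotomeTransport (X Y : TemperedCurve p) : Type where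
  /-- `μ_Ẑ(K̄) → I_x ⊆ Π^temp_{X_K}` for a cusp `x` (the natural isomorphism onto `I_x`) -/
  cycloToInertiaX : (x : X.Pt) → (cyclotome (AlgebraicClosure ℚ_[p])ˣ →* X.PiTemp)
  /-- `μ_Ẑ(L̄) → I_y ⊆ Π^temp_{Y_L}` for a cusp `y` -/
  cycloToInertiaY : (y : Y.Pt) → (cyclotome (AlgebraicClosure ℚ_[p])ˣ →* Y.PiTemp)
  /-- its image is `I_x` -/
  range_cycloToInertiaX : ∀ x, X.IsCusp x → X.IsRationalPt x → (cycloToInertiaX x).range = X.inertia x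
  /-- its image is `I_y` -/
  range_cycloToInertiaY : ∀ y, Y.IsCusp y → Y.IsRationalPt y → (cycloToInertiaY y).range = Y.inertia y
  /-- the isomorphism `μ_Ẑ(K̄) ≅ μ_Ẑ(L̄)` induced by an isomorphism of tempered groups -/
  cycloOf : (X.PiTemp ≃ₜ* Y.PiTemp) → (cyclotome (AlgebraicClosure ℚ_[p])ˣ ≃* cyclotome (AlgebraicClosure ℚ_[p])ˣ)

/-- ORIGIN hypotheses for the interface data of this file (extending `TemperedMorphismOrigin p`;
threaded as a parameter, never constructed): "`S` IS the pair of canonical structures of [Mzk8]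
Def. 4.1 (iii) for `X_K`", "`k` IS `H¹(Π_{X_K}, μ_Ẑ(K))` with the Kummer image of the units", "`t`
IS the transport induced by isomorphisms", "`c` IS the natural cyclotome data".
[cite: MochizukiSemiAnbd2006, §6 pp.77-78] -/
structure AbsolutenessOrigin (p : ℕ) [Fact p.Prime] extends TemperedMorphismOrigin p where
  /-- genuine canonical integral/discrete structures -/
  IsStructuresOrigin : ∀ {X : TemperedCurve p}, CuspidalStructures X → Prop
  /-- genuine Kummer data -/
  IsKummerOrigin : ∀ {X : TemperedCurve p}, KummerUnitData X → Prop
  /-- genuine Kummer transport for a pair -/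
  IsKummerTransportOrigin : ∀ {X Y : TemperedCurve p} {kX : KummerUnitData X}
    {kY : KummerUnitData Y}, KummerTransport kX kY → Prop
  /-- genuine cyclotome data for a pair -/
  IsCyclotomeOrigin : ∀ {X Y : TemperedCurve p}, CyclotomeTransport X Y → Prop

namespace AbsolutenessOrigin

variable (Ω : AbsolutenessOrigin p)

/-! ### [Mzk8] Def. 4.1 (iv) / 4.8 and their "temp-" analogues (p. 77) -/

/-- **[Mzk8] Definition 4.1 (iv)** with the "temp-" prefix of [SemiAnbd] p. 77: the cusp `x` of
`X_K` is *integrally temp-absolute* if for every hyperbolic curve `Y_L` and every isomorphism of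
TEMPERED groups `α : Π^temp_{X_K} ≅ Π^temp_{Y_L}`, the isomorphism `D_x ≅ D_y` induced by `α` (`y` the
cusp of `Y_L` with `α(D_x)` conjugate to `D_y`, Thm. 6.5 (iii)) "is compatible with the canonical
integral structures on `D_x`, `D_y`". [cite: MochizukiSemiAnbd2006, §6 p.77] -/
def IsIntegrallyTempAbsoluteCusp {X : TemperedCurve p} (SX : CuspidalStructures X)
    (x : X.Pt) : Prop :=
  ∀ (Y : TemperedCurve p) (SY : CuspidalStructures Y),
    Ω.IsHyperbolicCurveOrigin Y → Ω.IsStructuresOrigin SY →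
    ∀ (α : X.PiTemp ≃ₜ* Y.PiTemp) (y : Y.Pt) (γ : ConjAct Y.PiTemp), Y.IsCusp y →
      (X.decomp x).map α.toMulEquiv.toMonoidHom = γ • Y.decomp y →
      (fun S => S.map α.toMulEquiv.toMonoidHom) '' SX.canonicalIntegral x =
        (fun S => γ • S) '' SY.canonicalIntegral y

/-- **[Mzk8] Definition 4.1 (iv)** with the "temp-" prefix: *discretely temp-absolute* cusp (same
with the canonical discrete structures). [cite: MochizukiSemiAnbd2006, §6 p.77] -/
def IsDiscretelyTempAbsoluteCusp {X : TemperedCurve p} (SX : CuspidalStructures X)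
    (x : X.Pt) : Prop :=
  ∀ (Y : TemperedCurve p) (SY : CuspidalStructures Y),
    Ω.IsHyperbolicCurveOrigin Y → Ω.IsStructuresOrigin SY →
    ∀ (α : X.PiTemp ≃ₜ* Y.PiTemp) (y : Y.Pt) (γ : ConjAct Y.PiTemp), Y.IsCusp y →
      (X.decomp x).map α.toMulEquiv.toMonoidHom = γ • Y.decomp y →
      (fun S => S.map α.toMulEquiv.toMonoidHom) '' SX.canonicalDiscrete x =
        (fun S => γ • S) '' SY.canonicalDiscrete y

/-- **[Mzk8] Definition 4.1 (iv)** (p. 34), profinite version: the cusp `x` is *integrally absolute*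
— "for every `Y_L`, `α` as in Theorem 2.3 [an isomorphism of PROFINITE groups `Π_{X_K} ≅ Π_{Y_L}`],
the isomorphism `D_x ≅ D_y` … induced by `α` is compatible with the canonical integral structures on
`D_x`, `D_y`" (structures transported to `D̂_x ⊆ Π_{X_K}`, p. 77). [cite: MochizukiSemiAnbd2006, §6 p.77] -/
def IsIntegrallyAbsoluteCusp {X : TemperedCurve p} (SX : CuspidalStructures X)
    (x : X.Pt) : Prop :=
  ∀ (Y : TemperedCurve p) (SY : CuspidalStructures Y),
    Ω.IsHyperbolicCurveOrigin Y → Ω.IsStructuresOrigin SY →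
    ∀ (α : X.PiHat ≃ₜ* Y.PiHat) (y : Y.Pt) (γ : ConjAct Y.PiHat), Y.IsCusp y →
      (X.decompHat x).map α.toMulEquiv.toMonoidHom = γ • Y.decompHat y →
      (fun S => S.map α.toMulEquiv.toMonoidHom) '' X.hatOf (SX.canonicalIntegral x) =
        (fun S => γ • S) '' Y.hatOf (SY.canonicalIntegral y)

/-- **[Mzk8] Definition 4.1 (iv)**, profinite version: *discretely absolute* cusp.
[cite: MochizukiSemiAnbd2006, §6 p.77] -/
def IsDiscretelyAbsoluteCusp {X : TemperedCurve p} (SX : CuspidalStructures X)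
    (x : X.Pt) : Prop :=
  ∀ (Y : TemperedCurve p) (SY : CuspidalStructures Y),
    Ω.IsHyperbolicCurveOrigin Y → Ω.IsStructuresOrigin SY →
    ∀ (α : X.PiHat ≃ₜ* Y.PiHat) (y : Y.Pt) (γ : ConjAct Y.PiHat), Y.IsCusp y →
      (X.decompHat x).map α.toMulEquiv.toMonoidHom = γ • Y.decompHat y →
      (fun S => S.map α.toMulEquiv.toMonoidHom) '' X.hatOf (SX.canonicalDiscrete x) =
        (fun S => γ • S) '' Y.hatOf (SY.canonicalDiscrete y)

/-- **[Mzk8] Definition 4.8** (p. 40) with the "temp-" prefix of [SemiAnbd] p. 77: `X_K` is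
*unitwise temp-absolute* if for every hyperbolic curve `Y_L` and every isomorphism of tempered groups
`α`, the induced isomorphism `H¹(Π^temp_{X_K}, μ_Ẑ(K)) ≅ H¹(Π^temp_{Y_L}, μ_Ẑ(L))` "maps the image of
`Γ(X_K, O^×_{X_K})` via the Kummer map onto the image of `Γ(Y_L, O^×_{Y_L})`".
[cite: MochizukiSemiAnbd2006, §6 p.77] -/
def IsUnitwiseTempAbsolute {X : TemperedCurve p} (kX : KummerUnitData X) : Prop :=
  ∀ (Y : TemperedCurve p) (kY : KummerUnitData Y) (t : KummerTransport kX kY),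
    Ω.IsHyperbolicCurveOrigin Y → Ω.IsKummerOrigin kY →
    Ω.IsKummerTransportOrigin t →
    ∀ α : X.PiTemp ≃ₜ* Y.PiTemp, (kX.unitImage).map (t.h1OfTemp α).toAddMonoidHom = kY.unitImage

/-- **[Mzk8] Definition 4.8** (p. 40), profinite version: `X_K` is *unitwise absolute* (same with
isomorphisms `α : Π_{X_K} ≅ Π_{Y_L}` of profinite groups). [cite: MochizukiSemiAnbd2006, §6 p.77] -/
def IsUnitwiseAbsolute {X : TemperedCurve p} (kX : KummerUnitData X) : Prop :=
  ∀ (Y : TemperedCurve p) (kY : KummerUnitData Y) (t : KummerTransport kX kY),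
    Ω.IsHyperbolicCurveOrigin Y → Ω.IsKummerOrigin kY →
    Ω.IsKummerTransportOrigin t →
    ∀ α : X.PiHat ≃ₜ* Y.PiHat, (kX.unitImage).map (t.h1OfHat α).toAddMonoidHom = kY.unitImage

/-! ### Corollary 6.10, Corollary 6.11 — as predicates -/

/-- **[SemiAnbd] Corollary 6.10 (i) (Tempered Absoluteness)**, p. 77: "The point `x` is a discretely
absolute cusp (respectively, an integrally absolute cusp) if and only if it is a discretely
temp-absolute cusp (respectively, an integrally temp-absolute cusp)."  The integral clause is
guarded by "`X_K` has stable reduction over `O_K`", under which alone [Mzk8] Def. 4.1 (iv) defines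
integral absoluteness (review of p406530). [cite: MochizukiSemiAnbd2006, Cor 6.10(i) p.77] -/
def AbsoluteIffTempAbsoluteCusp {X : TemperedCurve p} (SX : CuspidalStructures X) : Prop :=
  ∀ x : X.Pt, X.IsCusp x → X.IsRationalPt x →
    (Ω.IsDiscretelyAbsoluteCusp SX x ↔ Ω.IsDiscretelyTempAbsoluteCusp SX x) ∧
    (SX.HasStableReduction →
      (Ω.IsIntegrallyAbsoluteCusp SX x ↔ Ω.IsIntegrallyTempAbsoluteCusp SX x))

/-- **[SemiAnbd] Corollary 6.10 (ii)**, p. 77: "The hyperbolic curve `X_K` is unitwise absolute if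
and only if it is unitwise temp-absolute." [cite: MochizukiSemiAnbd2006, Cor 6.10(ii) p.77] -/
def UnitwiseAbsoluteIffTempAbsolute {X : TemperedCurve p} (kX : KummerUnitData X) : Prop :=
  Ω.IsUnitwiseAbsolute kX ↔ Ω.IsUnitwiseTempAbsolute kX

/-- **[SemiAnbd] Corollary 6.11 (Unitwise and Integral Temp-absoluteness for Genus Zero)**,
p. 77: "Let `X_K` be a hyperbolic curve over `K`, with stable reduction over `O_K`, which is
isogenous to a hyperbolic curve of genus zero. Then `X_K` is unitwise temp-absolute, and every cusp
of `X_K` is integrally temp-absolute" (cusps of `X_K`, i.e. `K`-rational cusps, for which the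
canonical integral structure is defined). [cite: MochizukiSemiAnbd2006, Cor 6.11 p.77] -/
def GenusZeroTempAbsoluteness {X : TemperedCurve p} (SX : CuspidalStructures X)
    (kX : KummerUnitData X) (aX : TemperedCurve.CurveArithmeticFlags X) : Prop :=
  SX.HasStableReduction → aX.IsIsogenousToGenusZero →
    Ω.IsUnitwiseTempAbsolute kX ∧
      ∀ x : X.Pt, X.IsCusp x → X.IsRationalPt x → Ω.IsIntegrallyTempAbsoluteCusp SX x

end AbsolutenessOrigin

/-! ### Theorem 6.12 (Rigidity of Cuspidal Geometric Decomposition Groups), p. 78 -/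

namespace TemperedCurve

/-- **[SemiAnbd] Theorem 6.12 (Rigidity of Cuspidal Geometric Decomposition Groups)**, p. 78: "In the
notation of Theorem 6.8, (ii) [`α : Π^temp_{X_K} ≅ Π^temp_{Y_L}`], suppose that `α` induces
isomorphisms `I_x ≅ I_y`; `μ_Ẑ(K̄) ≅ μ_Ẑ(L̄)` where `x ∈ X̄_K(K)` (respectively, `y ∈ Ȳ_L(L)`) is a
cusp; `μ_Ẑ(−)` is as in [Mzk8], Theorem 4.3. Then these isomorphisms are compatible with the natural
isomorphisms `μ_Ẑ(K̄) ≅ I_x`; `μ_Ẑ(L̄) ≅ I_y`." [cite: MochizukiSemiAnbd2006, Thm 6.12 p.78] -/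
def CuspidalCyclotomicRigidity (X : TemperedCurve p) (Y : TemperedCurve p)
    (c : CyclotomeTransport X Y) : Prop :=
  ∀ (α : X.PiTemp ≃ₜ* Y.PiTemp) (x : X.Pt) (y : Y.Pt), X.IsCusp x → X.IsRationalPt x → Y.IsCusp y →
    Y.IsRationalPt y → (X.inertia x).map α.toMulEquiv.toMonoidHom = Y.inertia y →
    ∀ ζ : cyclotome (AlgebraicClosure ℚ_[p])ˣ,
      α (c.cycloToInertiaX x ζ) = c.cycloToInertiaY y (c.cycloOf α ζ)

end TemperedCurve

/-! ### The printed statements over the origin predicates -/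

namespace AbsolutenessOrigin

/-- **[SemiAnbd] Corollary 6.10 (i), (ii)** (p. 77) as printed: for every hyperbolic curve `X_K`
over a finite extension of `ℚ_p` with its genuine [Mzk8] §4 structures.
[cite: MochizukiSemiAnbd2006, Cor 6.10 p.77] -/
def TemperedAbsolutenessHolds (Ω : AbsolutenessOrigin p) : Prop :=
  ∀ (X : TemperedCurve p) (SX : CuspidalStructures X) (kX : KummerUnitData X),
    Ω.IsHyperbolicCurveOrigin X → Ω.IsStructuresOrigin SX →
    Ω.IsKummerOrigin kX → Ω.AbsoluteIffTempAbsoluteCusp SX ∧ Ω.UnitwiseAbsoluteIffTempAbsolute kX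

/-- **[SemiAnbd] Corollary 6.11** (p. 77) as printed. [cite: MochizukiSemiAnbd2006, Cor 6.11 p.77] -/
def GenusZeroTempAbsolutenessHolds (Ω : AbsolutenessOrigin p) : Prop :=
  ∀ (X : TemperedCurve p) (SX : CuspidalStructures X) (kX : KummerUnitData X)
    (aX : TemperedCurve.CurveArithmeticFlags X), Ω.IsHyperbolicCurveOrigin X →
    Ω.IsStructuresOrigin SX → Ω.IsKummerOrigin kX → Ω.IsFlagsOrigin aX →
    Ω.GenusZeroTempAbsoluteness SX kX aX

/-- **[SemiAnbd] Theorem 6.12** (p. 78) as printed: for all hyperbolic curves `X_K`, `Y_L` over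
finite extensions of `ℚ_p` with their genuine cyclotome data.
[cite: MochizukiSemiAnbd2006, Thm 6.12 p.78] -/
def CuspidalCyclotomicRigidityHolds (Ω : AbsolutenessOrigin p) : Prop :=
  ∀ (X Y : TemperedCurve p) (c : CyclotomeTransport X Y),
    Ω.IsHyperbolicCurveOrigin X → Ω.IsHyperbolicCurveOrigin Y →
    Ω.IsCyclotomeOrigin c → X.CuspidalCyclotomicRigidity Y c

end AbsolutenessOrigin

end Literature.AnabelianGeometry.SemiGraphs

end
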